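import Summits.BirchSwinnertonDyer.BirchSwinnertonDyer.Theorems.UniversalToricDescentResidualSelmerLocal
import Summits.BirchSwinnertonDyer.BirchSwinnertonDyer.Theorems.UniversalToricDescentResidualSelmerComparison
import Summits.BirchSwinnertonDyer.Rank1Residual.O6.X4CongruenceAnchor
import Literature.NumberTheory.EllipticCurves.HeegnerPointsKolyvaginConjugation
import HarnessLib

/-!
# Route UniversalToricDescent — the residual Selmer comparison and the Greenberg–Vatsal `μ = 0` /
# torsion transport for Castella's anticyclotomic Selmer groups along `E₁[p] ≅ E₂[p]`, UNCONDITIONAL in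
# the local lemma (port-grade child B′1 of crux 20399 at a common imprimitivity set `Σ`)

Lead prover bsd-wall-utd-p1 g6 (`--supports stmt-BirchSwinnertonDyer-20399`; PRICING-20399-ALG-HALF §3(a)). The
hypothesis (H) of `UniversalToricDescentResidualSelmerComparison` is discharged by
`UniversalToricDescentResidualSelmerLocal.torsionToPrimaryH1Sub_mem_awayKer_of_mem_unramifiedKer_kerSubgroup`
at every good place `v ∤ p`; hence, for any number field `K`, any `ℤ_p`-extension `κ` (topological generator
`γ`), `p` odd, `𝔭 ∋ p` finitely decomposed in `K_∞` (`D_𝔭 ⊄ ker κ`; Brink Cor. 1 for the anticyclotomic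
extension of an imaginary quadratic field, route leaf 20466) and a finite `Σ ∌ 𝔭` containing the bad places
of BOTH curves prime to `p`:

* `finite_residualSelmer_of_finite_selmerAc_pTorsion'` — `Sel_𝔭^Σ(K_∞, E[p^∞])[p]` finite ⟹
  `R_𝔭^Σ(K_∞, E[p])` finite;
* **`finite_selmerAc_pTorsion_transfer_of_torsionIso`** — for `E₁[p] ≅ E₂[p]` as `Γ_K`-modules,
  `Sel_𝔭^Σ(K_∞, E₁[p^∞])[p]` finite ⟹ `Sel_𝔭^Σ(K_∞, E₂[p^∞])[p]` finite (Greenberg–Vatsal Prop. (2.8) /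
  p. 26 for Castella's conditions, with NO hypothesis at the places above `p`, on `E(K_v)[p]`, or on
  irreducibility);
* **`isTorsion_and_exists_generator_transfer_of_torsionIso'`** — `X_ac^Σ(E₁)` `Λ`-torsion with
  `Ch_Λ·R₀⟦T⟧ = (g₁)`, `g₁` with a norm-one coefficient ⟹ the same for `X_ac^Σ(E₂)` (the route's
  `R₀⟦T⟧`-currency; Λ-side `UniversalToricDescentAcDualMuZeroCriterion`).

* `exists_torsionIso_baseChange_of_modPCongruent`, **`isTorsion_and_exists_generator_transfer_of_modPCongruent`**
  — the same in the route's binders: `W, W′/ℚ` with `O6.ModPCongruent W′ W p` (the twin binder of crux 20186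
  / 20399 / B′1), base-changed to the number field `K` (`RatClosure.torsionEquiv` transports the
  `Γ_ℚ`-isomorphism `W′[p] ≅ W[p]` to a `Γ_K`-isomorphism of the base changes), `X = AcSelmer.XAc (W.baseChange K) p κ 𝔭 Σ γ`.

What separates this from the route's B′1 / `InvariantsTransportModThreeT` at `Σ = ∅`: the twin's
`Σ`-passage `∅ → Σ` (local finiteness of `H¹(K_{∞,w}, E′[p^∞])[p]` at the bad, finitely decomposed `w`,
Greenberg–Vatsal Prop. (2.4)) — not here; the `E`-side passage `Σ → ∅` is `selmerAc_empty_le`.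

THEOREMS ONLY; no definition, no named fact, no `sorry`. BSD is not advanced by this file.
References: [GreenbergVatsal2000] §2 Prop. (2.4), (2.8), p. 26, Thm. (1.4) (algebraic half);
[LimSujatha2018] §3 Prop. 3.2; [Castella2018] Def. 2.2, Thm. 2.3; [Brink2007] Cor. 1.
-/

set_option autoImplicit false
-- `…BirchSwinnertonDyer.BirchSwinnertonDyer.Theorems…` is the problem's mandated namespace (D-0017).
set_option linter.dupNamespace false

noncomputable section

open scoped Classical

namespace Summit.BirchSwinnertonDyer.BirchSwinnertonDyer.Theorems.UniversalToricDescentResidualSelmerTransfer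

open NumberField IsDedekindDomain Field
open Literature.NumberTheory.EllipticCurves Literature.NumberTheory.EllipticCurves.GreenbergSelmer
  Literature.NumberTheory.EllipticCurves.GreenbergVatsal2000
  Literature.NumberTheory.GaloisRepresentations WeierstrassCurve
  Summit.BirchSwinnertonDyer.Rank1Residual.X11b Summit.BirchSwinnertonDyer.Rank1Residual.X11b.AcSelmer
  Summit.BirchSwinnertonDyer.BirchSwinnertonDyer.Theorems.UniversalToricDescentResidualSelmerLocal

section Transfer

open Summit.BirchSwinnertonDyer.BirchSwinnertonDyer.Theorems.UniversalToricDescentAcDualMuZero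
  Summit.BirchSwinnertonDyer.BirchSwinnertonDyer.Theorems.UniversalToricDescentResidualSelmer
  Summit.BirchSwinnertonDyer.BirchSwinnertonDyer.Theorems.UniversalToricDescentResidualSelmerFinite
  Summit.BirchSwinnertonDyer.BirchSwinnertonDyer.Theorems.UniversalToricDescentResidualSelmerComparison

variable {K : Type} [Field K] [NumberField K] {p : ℕ} [Fact p.Prime] (κ : ZpExtension K p)

/-- **`Sel_𝔭^Σ(K_∞, E[p^∞])[p]` finite ⟹ `R_𝔭^Σ(K_∞, E[p])` finite** — the twin-side half of the
residual comparison, now UNCONDITIONAL: any number field `K`, any `ℤ_p`-extension `κ`, `p` odd, `p ∈ 𝔭`,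
`Σ` containing the bad places of `E` prime to `p` (so that (H) = §3 applies at every `v ∉ Σ`, `v ∤ p`).
[cite: GreenbergVatsal2000, §2 p. 26] [cite: LimSujatha2018, §3 (proof of Prop. 3.2)] -/
theorem finite_residualSelmer_of_finite_selmerAc_pTorsion' (W : WeierstrassCurve K) [W.IsElliptic]
    (hp : p ≠ 2) {𝔭 : HeightOneSpectrum (𝓞 K)} (h𝔭 : ((p : ℕ) : 𝓞 K) ∈ 𝔭.asIdeal)
    {S : Set (HeightOneSpectrum (𝓞 K))}
    (hS : ∀ v : HeightOneSpectrum (𝓞 K), v ∉ S → ((p : ℕ) : 𝓞 K) ∉ v.asIdeal → W.HasGoodReductionAt v)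
    (hfin : Set.Finite {s : selmerAc W p κ 𝔭 S | p • s = 0}) :
    (datumStrictSelmer κ.kerSubgroup (W.geomTorsion (p : ℤ)) p (AcSelmer.bdpData _ p 𝔭) S :
      Set (Literature.NumberTheory.EllipticCurves.subgroupH1 κ.kerSubgroup
        (W.geomTorsion (p : ℤ)))).Finite :=
  finite_residualSelmer_of_finite_selmerAc_pTorsion W κ hp h𝔭
    (fun v hvS hpv _ hy ↦
      torsionToPrimaryH1Sub_mem_awayKer_of_mem_unramifiedKer_kerSubgroup W p κ hpv (hS v hvS hpv) hy)
    hfin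

/-- **The residual Selmer comparison (Greenberg–Vatsal Prop. (2.8) for Castella's anticyclotomic
Selmer groups, in the finiteness form): for `E₁[p] ≅ E₂[p]` as `Γ_K`-modules,
`Sel_𝔭^Σ(K_∞, E₁[p^∞])[p]` finite ⟹ `Sel_𝔭^Σ(K_∞, E₂[p^∞])[p]` finite** — any number field `K`, ANY
`ℤ_p`-extension `κ`, `p` odd, `𝔭 ∋ p` finitely decomposed in `K_∞` (`D_𝔭 ⊄ ker κ`), `Σ ∌ 𝔭` containing
the bad places of `E₁` and of `E₂` prime to `p`. No hypothesis on the reduction of `E₁, E₂` at the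
places above `p`, none on `E(K_v)[p]`, no irreducibility. [cite: GreenbergVatsal2000, §2 Prop. (2.8) and p. 26] -/
theorem finite_selmerAc_pTorsion_transfer_of_torsionIso (W₁ W₂ : WeierstrassCurve K) [W₁.IsElliptic]
    [W₂.IsElliptic] (hp : p ≠ 2) {𝔭 : HeightOneSpectrum (𝓞 K)} (h𝔭 : ((p : ℕ) : 𝓞 K) ∈ 𝔭.asIdeal)
    (h𝔭dec : ¬ (decomp 𝔭 ≤ κ.kerSubgroup)) {S : Set (HeightOneSpectrum (𝓞 K))}
    (hS₁ : ∀ v : HeightOneSpectrum (𝓞 K), v ∉ S → ((p : ℕ) : 𝓞 K) ∉ v.asIdeal → W₁.HasGoodReductionAt v)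
    (hS₂ : ∀ v : HeightOneSpectrum (𝓞 K), v ∉ S → ((p : ℕ) : 𝓞 K) ∉ v.asIdeal → W₂.HasGoodReductionAt v)
    (e : W₁.geomTorsion (p : ℤ) ≃+ W₂.geomTorsion (p : ℤ))
    (he : ∀ (σ : absoluteGaloisGroup K) (P : W₁.geomTorsion (p : ℤ)), e (σ • P) = σ • e P)
    (hfin : Set.Finite {s : selmerAc W₁ p κ 𝔭 S | p • s = 0}) :
    Set.Finite {s : selmerAc W₂ p κ 𝔭 S | p • s = 0} :=
  finite_selmerAc_pTorsion_of_finite_residualSelmer W₂ κ h𝔭 h𝔭dec hS₂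
    ((finite_residualSelmer_geomTorsion_iff_of_torsionIso W₁ W₂ κ 𝔭 S e he).mp
      (finite_residualSelmer_of_finite_selmerAc_pTorsion' κ W₁ hp h𝔭 hS₁ hfin))

/-- **The Greenberg–Vatsal transport of `Λ`-torsion and `μ = 0` for Castella's `X_ac^Σ`, along
`E₁[p] ≅ E₂[p]`, UNCONDITIONAL in the local lemma** (any number field `K`, any `ℤ_p`-extension with a
topological generator `γ`, `p` odd, `𝔭 ∋ p` with `D_𝔭 ⊄ ker κ` — Brink Cor. 1 in the anticyclotomic case —
`Σ ∌ 𝔭` finite containing the bad places of both curves prime to `p`): if `X_ac^Σ(E₁)` is `Λ`-torsion with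
`Ch_Λ·R₀⟦T⟧ = (g₁)`, `g₁` with a norm-one coefficient, then so is `X_ac^Σ(E₂)`. This is the port-grade
child B′1 of crux 20399 at a common imprimitivity set `Σ` ("whether `μ = 0` and `Sel` is cotorsion is
determined by `E[p]`"). [cite: GreenbergVatsal2000, §2 Prop. (2.8), p. 26, Thm. (1.4) (algebraic half)] -/
theorem isTorsion_and_exists_generator_transfer_of_torsionIso' (W₁ W₂ : WeierstrassCurve K)
    [W₁.IsElliptic] [W₂.IsElliptic] (𝔭 : HeightOneSpectrum (𝓞 K)) (S : Set (HeightOneSpectrum (𝓞 K)))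
    (γ : absoluteGaloisGroup K) [Fact (κ.IsTopGenerator γ)] (hp : p ≠ 2)
    (h𝔭 : ((p : ℕ) : 𝓞 K) ∈ 𝔭.asIdeal) (h𝔭dec : ¬ (decomp 𝔭 ≤ κ.kerSubgroup)) (hSfin : S.Finite)
    (hS₁ : ∀ v : HeightOneSpectrum (𝓞 K), v ∉ S → ((p : ℕ) : 𝓞 K) ∉ v.asIdeal → W₁.HasGoodReductionAt v)
    (hS₂ : ∀ v : HeightOneSpectrum (𝓞 K), v ∉ S → ((p : ℕ) : 𝓞 K) ∉ v.asIdeal → W₂.HasGoodReductionAt v)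
    (e : W₁.geomTorsion (p : ℤ) ≃+ W₂.geomTorsion (p : ℤ))
    (he : ∀ (σ : absoluteGaloisGroup K) (P : W₁.geomTorsion (p : ℤ)), e (σ • P) = σ • e P)
    (hT₁ : Module.IsTorsion (IwasawaAlgebra p) (XAc W₁ p κ 𝔭 S γ))
    (hg₁ : ∃ g : UnrSeries p,
      (XAc.charIdeal W₁ p κ 𝔭 S γ).map (PowerSeries.map (Halves.toUnr p)) = Ideal.span {g} ∧
        ∃ i : ℕ, ‖((PowerSeries.coeff i g : unrIntegers p) : ℂ_[p])‖ = 1) :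
    Module.IsTorsion (IwasawaAlgebra p) (XAc W₂ p κ 𝔭 S γ) ∧
      ∃ g : UnrSeries p,
        (XAc.charIdeal W₂ p κ 𝔭 S γ).map (PowerSeries.map (Halves.toUnr p)) = Ideal.span {g} ∧
          ∃ i : ℕ, ‖((PowerSeries.coeff i g : unrIntegers p) : ℂ_[p])‖ = 1 :=
  isTorsion_and_exists_generator_transfer_of_torsionIso W₁ W₂ κ 𝔭 S γ hp h𝔭 h𝔭dec hSfin hS₂ e he
    (fun v hvS hpv _ hy ↦
      torsionToPrimaryH1Sub_mem_awayKer_of_mem_unramifiedKer_kerSubgroup W₁ p κ hpv (hS₁ v hvS hpv) hy)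
    hT₁ hg₁

end Transfer

/-! ### The route's binders: twins over `ℚ` (`ModPCongruent`), base-changed to `K` -/

section RouteShape

open Summit.BirchSwinnertonDyer.Rank1Residual.O6 Literature.NumberTheory.EllipticCurves.RatClosure
  Summit.BirchSwinnertonDyer.BirchSwinnertonDyer.Theorems.UniversalToricDescentResidualSelmerComparison

variable (W W' : WeierstrassCurve ℚ) {p : ℕ} [Fact p.Prime] (K : Type) [Field K] [NumberField K]

omit [Fact p.Prime] in
/-- **A `Γ_ℚ`-isomorphism `W′[p] ≅ W[p]` base-changes to a `Γ_K`-isomorphism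
`(W′_K)[p] ≅ (W_K)[p]`** for every number field `K` (transport along the tree's
`RatClosure.torsionEquiv : E(ℚ̄)[n] ≃ E_K(K̄)[n]`, equivariant for `Γ_K → Γ_ℚ`). [cite: Serre1972, §4] -/
theorem exists_torsionIso_baseChange_of_modPCongruent (hcong : ModPCongruent W' W p) :
    ∃ e : (W'.baseChange K).geomTorsion (p : ℤ) ≃+ (W.baseChange K).geomTorsion (p : ℤ),
      ∀ (σ : absoluteGaloisGroup K) (P : (W'.baseChange K).geomTorsion (p : ℤ)), e (σ • P) = σ • e P := by
  obtain ⟨e₀, he₀⟩ := hcong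
  refine ⟨((torsionEquiv (K := K) W' (p : ℤ)).symm.trans e₀).trans (torsionEquiv (K := K) W (p : ℤ)),
    fun σ Q ↦ ?_⟩
  obtain ⟨P, rfl⟩ := (torsionEquiv (K := K) W' (p : ℤ)).surjective Q
  rw [← torsionEquiv_smul, AddEquiv.trans_apply, AddEquiv.trans_apply, AddEquiv.symm_apply_apply,
    AddEquiv.trans_apply, AddEquiv.trans_apply, AddEquiv.symm_apply_apply, he₀, torsionEquiv_smul]

variable [W.IsElliptic] [W'.IsElliptic] (κ : ZpExtension K p) (𝔭 : HeightOneSpectrum (𝓞 K))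
  (S : Set (HeightOneSpectrum (𝓞 K))) (γ : absoluteGaloisGroup K) [Fact (κ.IsTopGenerator γ)]

/-- **The transport in the route's binders (child B′1 `TorsionMuTransportModThree` of crux 20399 at a
common `Σ`).** `W, W′` elliptic curves over `ℚ` with `W′[p] ≅ W[p]` (`ModPCongruent W′ W p`), `K` a number
field, `κ` ANY `ℤ_p`-extension of `K` with topological generator `γ`, `p` odd, `𝔭 ∋ p` with `D_𝔭 ⊄ ker κ`,
`Σ ∌ 𝔭` finite such that `W_K` and `W′_K` have good reduction at every `v ∉ Σ`, `v ∤ p`: if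
`X_ac^Σ(W′_K)` is `Λ`-torsion with `Ch_Λ·R₀⟦T⟧ = (g′)`, `g′` with a norm-one coefficient, then so is
`X_ac^Σ(W_K)`. [cite: GreenbergVatsal2000, §2 Prop. (2.8), p. 26] -/
theorem isTorsion_and_exists_generator_transfer_of_modPCongruent (hp : p ≠ 2)
    (h𝔭 : ((p : ℕ) : 𝓞 K) ∈ 𝔭.asIdeal) (h𝔭dec : ¬ (decomp 𝔭 ≤ κ.kerSubgroup)) (hSfin : S.Finite)
    (hS : ∀ v : HeightOneSpectrum (𝓞 K), v ∉ S → ((p : ℕ) : 𝓞 K) ∉ v.asIdeal →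
      (W.baseChange K).HasGoodReductionAt v)
    (hS' : ∀ v : HeightOneSpectrum (𝓞 K), v ∉ S → ((p : ℕ) : 𝓞 K) ∉ v.asIdeal →
      (W'.baseChange K).HasGoodReductionAt v)
    (hcong : ModPCongruent W' W p)
    (hT' : Module.IsTorsion (IwasawaAlgebra p) (XAc (W'.baseChange K) p κ 𝔭 S γ))
    (hg' : ∃ g : UnrSeries p,
      (XAc.charIdeal (W'.baseChange K) p κ 𝔭 S γ).map (PowerSeries.map (Halves.toUnr p)) =
          Ideal.span {g} ∧
        ∃ i : ℕ, ‖((PowerSeries.coeff i g : unrIntegers p) : ℂ_[p])‖ = 1) :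
    Module.IsTorsion (IwasawaAlgebra p) (XAc (W.baseChange K) p κ 𝔭 S γ) ∧
      ∃ g : UnrSeries p,
        (XAc.charIdeal (W.baseChange K) p κ 𝔭 S γ).map (PowerSeries.map (Halves.toUnr p)) =
            Ideal.span {g} ∧
          ∃ i : ℕ, ‖((PowerSeries.coeff i g : unrIntegers p) : ℂ_[p])‖ = 1 := by
  obtain ⟨e, he⟩ := exists_torsionIso_baseChange_of_modPCongruent W W' K hcong
  exact isTorsion_and_exists_generator_transfer_of_torsionIso' κ (W'.baseChange K) (W.baseChange K) 𝔭 S γ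
    hp h𝔭 h𝔭dec hSfin hS' hS e he hT' hg'

end RouteShape

end Summit.BirchSwinnertonDyer.BirchSwinnertonDyer.Theorems.UniversalToricDescentResidualSelmerTransfer

end
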